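/-
Copyright: lit-balaban Phase-2 proof seat p30 (gen 27).  Statement-level skeleton of a published paper; no proof claims beyond what
the kernel checks below.
-/
import Literature.MathematicalPhysics.QuantumFieldTheory.BalabanImbrieJaffe1984to88.BIJ85SmallFieldHarmonicMeanValue
import Literature.MathematicalPhysics.QuantumFieldTheory.BalabanImbrieJaffe1984to88.BIJ88NeumannPropagatorSmallFieldCubeDeriv

/-!
# [BalabanImbrieJaffe1985] §7.3 p. 326 ⟵ [Balaban1983RegularityDecay] Theorem p. 573, (1.11)–(1.12): **THE `δG_k(□, Ω)` VALUE MEMBER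
# AT SMALL NON-FLAT `U(1)` FIELDS — `|(G_k(□,u)f)(x) − (G_k(Ω,u)f)(x)| ≤ (L^kε)²c₁e^{−δ₁dist(x,supp f)/L^k}e^{−δ₁(dist(x,□^c)+dist(supp f,□^c))/L^k}‖f‖_∞`
# ON THE DEEP ROWS OF NESTED BLOCK UNIONS `□ ⊆ Ω`, UNIFORMLY IN `k`, IN THE (H1.12″) BINDER SHAPE OF p31's `BIJ88DeltaLocClose235General`**
# (kernel file 3 of 3; sibling 1 = `BIJ85SmallFieldHarmonicAgmon`, sibling 2 = `BIJ85SmallFieldHarmonicMeanValue`)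

T. Bałaban, J. Imbrie, A. Jaffe, *Renormalization of the Higgs model: minimizers, propagators and the stability of mean field theory*,
Commun. Math. Phys. **97** (1985) 299–329 [BalabanImbrieJaffe1985], row **C1.Eq7.3.1-7.3.2** (owner r15) / front **C2S14 (β′)** (owner r18:
the `(H1.12)` closeness input of p31's `(2.31)_k ⟸ (1.10)–(1.12)` chain at plaquette-small non-flat fields); [7] = T. Bałaban, *Regularity and
decay of lattice Green's functions*, Commun. Math. Phys. **89** (1983) 571–597 [Balaban1983RegularityDecay]; the consumer shape is
[BalabanImbrieJaffe1988] (2.31) p. 263 through `BIJ88DeltaLocClose235General.opClose231_gen` (hypothesis `hC`).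

statement-level skeleton of published theorems with citation tags; proofs where landed; nothing here is a claim about the Yang–Mills mass gap

PDFs held and re-read this session: `paper:balaban1983-cmp89-regularity-decay` p. 573 = PDF 3, lines 12–25, the Theorem: *"there exist
positive constants δ₀, c₀, R₀ independent of A, k, Ω … (1.10) |(G_k(Ω,A)f)(x)| ≤ c₀exp(−δ₀dist(x, supp f))‖f‖_∞ for x ∈ Ω, dist(x,Ω^c) ≥ R₀.
If Ω ⊂ Ω₀, then for δG_k(Ω,Ω₀,A) defined by the equality δG_k(Ω,Ω₀,A) = G_k(Ω,A) − G_k(Ω₀,A), (1.11) we have the inequalities (1.5) and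
(1.6) (with the same restrictions on x, x′) with the additional factor (1.12) on the right hand sides"* ((1.12) =
`exp(−δ₀dist(x, Ω^c))·exp(−δ₀dist(supp f, Ω^c))`, cf. (1.7) p. 572); `paper:balaban1985-cmp97-bij-higgs-minimizers` p. 326 = PDF 28, lines
18–22: *"The propagators arising from Δ_k(u_k), under the restriction (7.3.1) on the gauge field, also satisfy the regularity and decay
estimates of [7]."*

WHAT THIS FILE PROVES (objects: p31's region Neumann propagators `G_k(X,u) = gBox (α_kL^{kd}) ε⁻¹ u k X` and whole-torus operator
`N(u) = nOp (α_kL^{kd}) ε⁻¹ u k T` on the fine torus, `X` a union of `k`-blocks (`IsBlockUnion`), `T(x,y) = |x − y|_∞` the sup torus distance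
in fine units = `B5Ineq137Torus.T P 0` (`B3Bound323ZeroTorus.T_eq_supDist`), distances measured in blocks through the factor `(L^k)⁻¹`):
* §1 **`nOp_univ_diff_apply_eq_zero`** — `v = G_k(□,u)f − G_k(Ω,u)f` is `N(u)`-harmonic at every site of `□` whose lattice neighbours lie
  in `□` (`□ ⊆ Ω` block unions; p34's interior-row identity and p31's `N_XG_X = 1_X`);
* §2 the depth `δ(y) = dist_∞(y, T ∖ □)` (**`exists_depth`**, `depth_le_add`, `interior_of_depth_two`), the collar cutoff
  `η = cl((δ − L^k − 2)/L^k)` (**`cutoff_props`**: `[0,1]`-valued, `1/L^k`-Lipschitz, `= 1` at depth `≥ 2L^k + 2`, `= 0` at depth `≤ L^k + 2`,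
  block-scale transition set inside the collar `{3 ≤ δ ≤ 3L^k + 1}`) and the tilt `g = −t|x − ·|_∞/L^k` (**`tilt_lipschitz`**);
* §3 **`agmon_step`** — sibling 1's `agmon_harmonic` for `N(u)` with the constants of record inserted: under `2d³(L^{2k}θ)² ≤ 1` and
  `t²(2d + a)e^{2t} ≤ m_*/2`, `m_* = min(a(1 − L^{−2})/2, 1/4)`:  `Σ(ηe^g)²‖ψ‖² ≤ (2e^{2t}(2d + a)/m_*)·Σ_S e^{2g}‖ψ‖²` — k-uniform;
* §4 kernel lemmas: gauge covariance of `N(u)` on vectors, `|x − y|_∞ ≤ |T|/2`, the exponent budget, the collar pointwise bound, the mass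
  near `x`;
* §5 the member of record **`close112_smallField_of_inputs`**: for `2 ≤ d ≤ 3`, `L` odd `> 1`, `a > 0`, `c₀ ≥ 0`, `δ₀ > 0` there are
  `c₁, δ₁ > 0` (depending on these only) such that for every volume, every `1 ≤ k ≤ K`, every `U(1)` field `u` with `|u(∂p) − 1| ≤ θ`,
  `2d³(L^{2k}θ)² ≤ 1`, all nested `k`-block unions `□ ⊆ Ω` on whose `□`-rows `G_k(□,u)` and `G_k(Ω,u)` obey the (H1.10″) value bound with
  `(c₀, δ₀)` (HYPOTHESES), every row `x ∈ □` with `dist_∞(x, T ∖ □) ≥ 10L^k` and every `f` (`‖f‖_∞ ≤ F`, `D ≤ dist(x, supp f)`,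
  `D_b ≤ dist(x, □^c)`, `D_f ≤ dist(supp f, □^c)`):
  `‖(G_k(□,u)f)(x) − (G_k(Ω,u)f)(x)‖ ≤ (L^kε)²·c₁e^{−δ₁D/L^k}e^{−δ₁(D_b + D_f)/L^k}·F`;
  and **`close112_smallField_hC`** — the same for a family of cubes `□_α ⊆ Ω` with row sets `X_α ⊆ {x ∈ □_α : dist_∞(x, □_α^c) ≥ 10L^k}`,
  literally the hypothesis `hC` of `BIJ88DeltaLocClose235General.opClose231_gen` (with its `(c₀, δ₀)` renamed `(c₁, δ₁)`; p31's
  `input110_mono`/`input112_mono` align the constants of `hGΩ` and `hC`).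

METHOD (ours).  (a) `v` is `N(u)`-harmonic on the interior of `□` (§1).  (b) Sibling 1's Agmon bound (Kato's inequality needs none: the
cutoff VANISHES near `∂□`, so no boundary term arises) with `η`, `g`, `S = collar`: the tilted mass `Σ(ηe^{g})²‖v‖²` is bounded by
`K₁·Σ_{collar}e^{2g}‖v‖²`, `K₁ = 2e^{2t}(2d + a)/m_*`, once `t = min(1, m_*/(16(2d + a)))`.  (c) On the collar both (H1.10″) members apply at
the row `y ∈ □` with the admissible distance `D′ = max(D_f − 3L^k − 1, D − |x − y|_∞, 0)`, so `‖v(y)‖ ≤ 2(L^kε)²c₀Fe^{−δ₀D′/L^k}`; the budget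
`e^{−2t|x−y|/L^k}e^{−2δ₀D′/L^k} ≤ e^{2t+4δ₀}·e^{−2δ₁(D + D_b + D_f)/L^k}·e^{−t|x−y|/L^k}` (`δ₁ = min(t/4, δ₀/2)`, using `|x − y|_∞ ≥ D_b − 3L^k − 1`)
and the torus radial sum `Σ_ye^{−t|x−y|/L^k} ≤ (2(1 + d/t))^dL^{kd}` (`BIJ85FreeResolventTiltedRow`) give
`Σ_{collar} ≤ (2(L^kε)²c₀F)²e^{2t+4δ₀}(2(1+d/t))^d·L^{kd}·EXP²`.  (d) On the ball `|x − y|_∞ ≤ 5L^k + 2` the cutoff is `1` and `e^{2g} ≥ e^{−14t}`.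
(e) In the centred axial gauge `h` around `x` of radius `2L^k` (`BIJ85CentredAxialGauge`: `|u^h − 1| ≤ (d − 1)θ|x − ·|_∞`, and
`(d − 1)θL^{2k} ≤ 1` by gen-25's `gamma_nsq_le_one`) the function `h·v` is `N(u^h)`-harmonic on `|x − ·|_∞ ≤ 4L^k + 2` (§4), so sibling 2's
`harmonic_meanValue` gives `‖v(x)‖√(L^{kd}) ≤ 2C·√(Σ_{ball}‖v‖²)`; the factor `L^{kd}` cancels and
`c₁ = 4C·c₀e^{t+2δ₀}√(e^{14t}K₁(2(1+d/t))^d) + 1`.  The small torus is vacuous (`|x − w|_∞ ≤ |T|/2` forces `|T| ≥ 20L^k`), `□ = T` is trivial.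

HONEST SCOPE.  (i) `U(1)` only, `2 ≤ d ≤ 3`, `L` odd `> 1`, `1 ≤ k ≤ K` — as siblings 1–2 and p27/p34's members.  (ii) VALUE member of
(1.11)–(1.12) only; the derivative member ((1.9)/(1.10)-`D` with the factor (1.12)) and the Hölder member are not treated here.  (iii) Rows at
sup-depth `≥ 10L^k` below `T ∖ □`: [7]'s restriction *"dist(x, Ω^c) ≥ R₀"* with OUR `R₀ = 10` block units (the print's `R₀` is not computed
there either); [7]'s remark that parallelepipeds need no restriction is NOT reproduced.  (iv) The (H1.10″) members for `□` and `Ω` are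
HYPOTHESES (binder shape of p27's `decay110_smallField_cube_input` / p31's `hGΩ`); instantiating them is p27's (torus, cubes:
`BIJ88NeumannPropagatorSmallFieldSupDecay`) and p34's (regions) lane, and that the backgrounds of the induction are plaquette-small at the
block scale (`2d³(L^{2k}θ)² ≤ 1`, stronger than (7.3.1)'s `e(ε)^{-1/4}`-type smallness when `L^{2k}` is large) is p33's lane — not restated.
(v) Constants explicit in the proof, depending on `(d, L, a, c₀, δ₀)` only; no optimisation.  DIVERGENCE OF METHOD, disclosed: the print
obtains (1.11)–(1.12) inside the random-walk expansion of [7]; here it is an energy (Caccioppoli–Agmon) plus mean-value argument for the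
difference of the two propagators, with our own constants and row restriction.  Kernel lemmas tagged [folklore] are real arithmetic and
clamp/min-max facts.  Nothing here is summit progress.  Unit `lit-balaban-p30` (literature-prover-lit-balaban-p30-g27-0), HOME
`run/shared/lean/pub/lit-balaban/`, 2026-08-23.
-/

open scoped BigOperators ComplexConjugate
open Finset Matrix

namespace Literature.MathematicalPhysics.QuantumFieldTheory.BalabanImbrieJaffe1984to88.BIJ88NeumannPropagatorSmallFieldClose

open Literature.MathematicalPhysics.QuantumFieldTheory.Balaban1983to89
open LatticeFieldCalculus (supDist)
open B3TorusRadialSums (supDist_comm supDist_eq_zero_iff)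
open BIJ85Ineq722Torus (supDist_triangle)
open BIJ88Sect3Statements (U1 toC cfg norm_toC toC_one)
open BIJ85BlockAveragesTorus BIJ85BlockAveragesTorusK
open BIJ88NeumannNoZeroModesTorus (IsBlockUnion)
open BIJ88NeumannPropagator227Torus (nOp gBox proj proj_mulVec gBox_univ_mul conj_mul_toC)
open BIJ88NeumannPropagatorSmallFieldRegion (nOp_mulVec_gBox_mulVec gBox_mulVec_eq_zero_of_not_mem)
open BIJ88NeumannPropagatorSmallFieldCubeDeriv (nOp_univ_mulVec_apply_eq_of_interior)
open BIJ85ScalarPropagatorSupDecayDeriv (gauge_transfer cfg_gaugeAct_apply norm_covDiff_gaugeAct dist1_plaqHol_le_of_plaqC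
  two_mul_pow_le_sitesPerDir gamma_nsq_le_one)
open BIJ85TorusTentCutoff (ball mem_ball supDist_shift_le_one' supDist_shift_le_succ supDist_le_shift_succ supDist_unshift_le_succ)
open BIJ85SmallFieldHarmonicAgmon (agmon_harmonic dist_supDist_le)
open BIJ85SmallFieldHarmonicMeanValue (harmonic_meanValue)

noncomputable section

variable {P : Params}

/-! ## §1 The difference `G_k(□)f − G_k(Ω)f` is `N(u)`-harmonic on the interior rows of `□` -/

/-- **`v = G_k(□,u)f − G_k(Ω,u)f` IS `N_T(u)`-HARMONIC ON THE INTERIOR OF `□`** (`□ ⊆ Ω` block unions): at a site `z ∈ □` all of whose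
lattice neighbours lie in `□`, the whole-torus operator row agrees with the `□`-row and with the `Ω`-row (p34's
`nOp_univ_mulVec_apply_eq_of_interior`), and `N_□G_□ = 1_□`, `N_ΩG_Ω = 1_Ω` (p31's `nOp_mul_gBox`), so `(N_T(u)v)(z) = f(z) − f(z) = 0`.
[cite: Balaban1983RegularityDecay, Theorem p.573 (1.11)] [cite: BalabanImbrieJaffe1988, (2.27) p.263] -/
theorem nOp_univ_diff_apply_eq_zero {k : ℕ} (hk : 0 + k ≤ P.m + P.K) {a c : ℝ} (hc : c ≠ 0) (ha : 0 < a) (U : GaugeField P 0 U1)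
    {B Ω : Finset (Balaban1983to89.Site P 0)} (hB : IsBlockUnion k B) (hΩ : IsBlockUnion k Ω) (hsub : B ⊆ Ω)
    (f : Balaban1983to89.Site P 0 → ℂ) {z : Balaban1983to89.Site P 0} (hz : z ∈ B) (hs : ∀ ν, z.shift ν ∈ B) (hu : ∀ ν, z.unshift ν ∈ B) :
    (nOp a c U k univ *ᵥ (fun y => (gBox a c U k B *ᵥ f) y - (gBox a c U k Ω *ᵥ f) y)) z = 0 := by
  have e : (fun y => (gBox a c U k B *ᵥ f) y - (gBox a c U k Ω *ᵥ f) y) = gBox a c U k B *ᵥ f - gBox a c U k Ω *ᵥ f := rfl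
  rw [e, mulVec_sub, Pi.sub_apply, nOp_univ_mulVec_apply_eq_of_interior a c U hB _ hz hs hu,
    nOp_univ_mulVec_apply_eq_of_interior a c U hΩ _ (hsub hz) (fun ν => hsub (hs ν)) (fun ν => hsub (hu ν)),
    nOp_mulVec_gBox_mulVec hk hc ha U hB, nOp_mulVec_gBox_mulVec hk hc ha U hΩ, proj_mulVec, proj_mulVec, if_pos hz, if_pos (hsub hz),
    sub_self]

/-! ## §2 The depth below the boundary of `□`, the collar cutoff and the tilt -/

/-- **THE DEPTH FUNCTION OF A PROPER SUBSET**: for `□ ≠ T` there is `δ : T → ℕ` with `δ(y) ≤ |y − w|_∞` for every `w ∉ □` and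
`δ(y) = |y − w₀|_∞` for some `w₀ ∉ □` (the sup-distance to the complement). [cite: Balaban1983RegularityDecay, Theorem p.573 (1.12)] -/
theorem exists_depth {B : Finset (Balaban1983to89.Site P 0)} (hB : B ≠ univ) :
    ∃ δ : Balaban1983to89.Site P 0 → ℕ, (∀ y w, w ∉ B → δ y ≤ supDist y w) ∧ (∀ y, ∃ w, w ∉ B ∧ δ y = supDist y w) := by
  classical
  have hne : (univ.filter fun w : Balaban1983to89.Site P 0 => w ∉ B).Nonempty := by
    by_contra h
    rw [Finset.not_nonempty_iff_eq_empty, Finset.filter_eq_empty_iff] at h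
    exact hB (Finset.eq_univ_of_forall fun w => by by_contra hw; exact h (mem_univ w) hw)
  refine ⟨fun y => (univ.filter fun w : Balaban1983to89.Site P 0 => w ∉ B).inf' hne (supDist y), fun y w hw => ?_, fun y => ?_⟩
  · exact Finset.inf'_le _ (by simp [hw])
  · obtain ⟨w, hw, he⟩ := Finset.exists_mem_eq_inf' hne (supDist y)
    exact ⟨w, (Finset.mem_filter.1 hw).2, he⟩

/-- kernel: the depth is `1`-Lipschitz for the sup distance: `δ(y) ≤ δ(y′) + |y − y′|_∞`. [cite: Balaban1983RegularityDecay, Theorem p.573 (1.12)] -/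
theorem depth_le_add {B : Finset (Balaban1983to89.Site P 0)} {δ : Balaban1983to89.Site P 0 → ℕ}
    (h1 : ∀ y w, w ∉ B → δ y ≤ supDist y w) (h2 : ∀ y, ∃ w, w ∉ B ∧ δ y = supDist y w) (y y' : Balaban1983to89.Site P 0) :
    δ y ≤ δ y' + supDist y y' := by
  obtain ⟨w, hw, he⟩ := h2 y'
  have := h1 y w hw
  have := supDist_triangle y y' w
  omega

/-- kernel: a site of positive depth lies in `□`. [cite: Balaban1983RegularityDecay, Theorem p.573 (1.12)] -/
theorem mem_of_depth_pos {B : Finset (Balaban1983to89.Site P 0)} {δ : Balaban1983to89.Site P 0 → ℕ}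
    (h1 : ∀ y w, w ∉ B → δ y ≤ supDist y w) {y : Balaban1983to89.Site P 0} (hy : 1 ≤ δ y) : y ∈ B := by
  by_contra h
  have := h1 y y h
  rw [(supDist_eq_zero_iff y y).2 rfl] at this
  omega

/-- kernel: a site of depth `≥ 2` is an interior site of `□` (all lattice neighbours in `□`). [cite: Balaban1983RegularityDecay, Theorem p.573 (1.12)] -/
theorem interior_of_depth_two {B : Finset (Balaban1983to89.Site P 0)} {δ : Balaban1983to89.Site P 0 → ℕ}
    (h1 : ∀ y w, w ∉ B → δ y ≤ supDist y w) (h2 : ∀ y, ∃ w, w ∉ B ∧ δ y = supDist y w) {y : Balaban1983to89.Site P 0}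
    (hy : 2 ≤ δ y) : y ∈ B ∧ (∀ ν, y.shift ν ∈ B) ∧ (∀ ν, y.unshift ν ∈ B) := by
  refine ⟨mem_of_depth_pos h1 (by omega), fun ν => mem_of_depth_pos h1 ?_, fun ν => mem_of_depth_pos h1 ?_⟩
  · have := depth_le_add h1 h2 y (y.shift ν); have := supDist_shift_le_one' y ν; omega
  · have := depth_le_add h1 h2 y (y.unshift ν); have := supDist_unshift_le_succ y y ν
    rw [(supDist_eq_zero_iff y y).2 rfl] at this; omega

/-- kernel: the clamp `cl(s) = min(1, max(0, s))` is `1`-Lipschitz. [folklore] -/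
private theorem abs_clamp_sub_le (s s' : ℝ) : |min 1 (max 0 s) - min 1 (max 0 s')| ≤ |s - s'| :=
  (abs_min_sub_min_le_max _ _ _ _).trans (by
    rw [sub_self, abs_zero, max_eq_right (abs_nonneg _)]
    exact (abs_max_sub_max_le_max _ _ _ _).trans (by rw [sub_self, abs_zero, max_eq_right (abs_nonneg _)]))

/-- kernel: the clamp takes values in `[0, 1]`. [folklore] -/
private theorem clamp_mem (s : ℝ) : 0 ≤ min 1 (max 0 s) ∧ min 1 (max 0 s) ≤ 1 :=
  ⟨le_min zero_le_one (le_max_left _ _), min_le_left _ _⟩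

/-- kernel: the clamp is `1` above `1`. [folklore] -/
private theorem clamp_eq_one {s : ℝ} (h : 1 ≤ s) : min 1 (max 0 s) = 1 := min_eq_left (h.trans (le_max_right _ _))

/-- kernel: the clamp is `0` below `0`. [folklore] -/
private theorem clamp_eq_zero {s : ℝ} (h : s ≤ 0) : min 1 (max 0 s) = 0 := by
  rw [max_eq_left h, min_eq_right zero_le_one]

/-- **THE COLLAR CUTOFF** `η(y) = cl((δ(y) − n − 2)/n)` (`n = L^k`): values in `[0,1]`, `1/n`-Lipschitz for the sup distance, `= 1` where
`δ ≥ 2n + 2`, `= 0` where `δ ≤ n + 2`; its block-scale transition set is inside `{3 ≤ δ ≤ 3n + 1}`.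
[cite: Balaban1983RegularityDecay, Theorem p.573 (1.12)] -/
theorem cutoff_props {B : Finset (Balaban1983to89.Site P 0)} {δ : Balaban1983to89.Site P 0 → ℕ}
    (h1 : ∀ y w, w ∉ B → δ y ≤ supDist y w) (h2 : ∀ y, ∃ w, w ∉ B ∧ δ y = supDist y w) (k : ℕ) :
    (∀ y, 0 ≤ min 1 (max 0 (((δ y : ℝ) - (P.L : ℝ) ^ k - 2) / (P.L : ℝ) ^ k)) ∧
      min 1 (max 0 (((δ y : ℝ) - (P.L : ℝ) ^ k - 2) / (P.L : ℝ) ^ k)) ≤ 1) ∧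
    (∀ y y', |min 1 (max 0 (((δ y : ℝ) - (P.L : ℝ) ^ k - 2) / (P.L : ℝ) ^ k)) -
        min 1 (max 0 (((δ y' : ℝ) - (P.L : ℝ) ^ k - 2) / (P.L : ℝ) ^ k))| ≤ (supDist y y' : ℝ) / (P.L : ℝ) ^ k) ∧
    (∀ y, 2 * P.L ^ k + 2 ≤ δ y → min 1 (max 0 (((δ y : ℝ) - (P.L : ℝ) ^ k - 2) / (P.L : ℝ) ^ k)) = 1) ∧
    (∀ y, δ y ≤ P.L ^ k + 2 → min 1 (max 0 (((δ y : ℝ) - (P.L : ℝ) ^ k - 2) / (P.L : ℝ) ^ k)) = 0) ∧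
    (∀ y y', supDist y y' ≤ P.L ^ k → min 1 (max 0 (((δ y : ℝ) - (P.L : ℝ) ^ k - 2) / (P.L : ℝ) ^ k)) ≠
        min 1 (max 0 (((δ y' : ℝ) - (P.L : ℝ) ^ k - 2) / (P.L : ℝ) ^ k)) → 3 ≤ δ y ∧ δ y ≤ 3 * P.L ^ k + 1) := by
  have hn0 : (0 : ℝ) < (P.L : ℝ) ^ k := pow_pos P.cast_L_pos k
  have hcast : ((P.L ^ k : ℕ) : ℝ) = (P.L : ℝ) ^ k := by push_cast; ring
  have hone : ∀ y, 2 * P.L ^ k + 2 ≤ δ y → min 1 (max 0 (((δ y : ℝ) - (P.L : ℝ) ^ k - 2) / (P.L : ℝ) ^ k)) = 1 := by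
    intro y hy
    refine clamp_eq_one ?_
    rw [le_div_iff₀ hn0]
    have : ((2 * P.L ^ k + 2 : ℕ) : ℝ) ≤ δ y := by exact_mod_cast hy
    push_cast at this
    linarith
  have hzero : ∀ y, δ y ≤ P.L ^ k + 2 → min 1 (max 0 (((δ y : ℝ) - (P.L : ℝ) ^ k - 2) / (P.L : ℝ) ^ k)) = 0 := by
    intro y hy
    refine clamp_eq_zero (div_nonpos_of_nonpos_of_nonneg ?_ hn0.le)
    have : (δ y : ℝ) ≤ ((P.L ^ k + 2 : ℕ) : ℝ) := by exact_mod_cast hy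
    push_cast at this
    linarith
  refine ⟨fun y => clamp_mem _, fun y y' => ?_, hone, hzero, fun y y' hd hne => ?_⟩
  · refine (abs_clamp_sub_le _ _).trans ?_
    rw [← sub_div, abs_div, abs_of_pos hn0]
    refine div_le_div_of_nonneg_right ?_ hn0.le
    have h := depth_le_add h1 h2 y y'
    have h' := depth_le_add h1 h2 y' y
    rw [supDist_comm y' y] at h'
    rw [abs_le]
    constructor
    · have : (δ y' : ℝ) ≤ δ y + supDist y y' := by exact_mod_cast h'
      linarith
    · have : (δ y : ℝ) ≤ δ y' + supDist y y' := by exact_mod_cast h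
      linarith
  · have h := depth_le_add h1 h2 y y'
    have h' := depth_le_add h1 h2 y' y
    rw [supDist_comm y' y] at h'
    constructor
    · by_contra hlt
      exact hne (by rw [hzero y (by omega), hzero y' (by omega)])
    · by_contra hlt
      exact hne (by rw [hone y (by omega), hone y' (by omega)])

/-- kernel: `||x − y|_∞ − |x − y′|_∞| ≤ |y − y′|_∞`. [folklore] -/
private theorem abs_supDist_sub_le (x y y' : Balaban1983to89.Site P 0) :
    |(supDist x y : ℝ) - (supDist x y' : ℝ)| ≤ (supDist y y' : ℝ) := by
  have h1 : (supDist x y' : ℝ) ≤ supDist x y + supDist y y' := by exact_mod_cast supDist_triangle x y y'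
  have h2 : (supDist x y : ℝ) ≤ supDist x y' + supDist y' y := by exact_mod_cast supDist_triangle x y' y
  have h3 : (supDist y' y : ℝ) = supDist y y' := by rw [supDist_comm]
  rw [abs_le]; constructor <;> linarith

/-- **THE TILT** `g(y) = −t|x − y|_∞/n` is `t/n`-Lipschitz for the sup distance. [cite: Balaban1983RegularityDecay, Theorem p.573 (1.12)] -/
theorem tilt_lipschitz (x : Balaban1983to89.Site P 0) {t n : ℝ} (ht : 0 ≤ t) (hn : 0 < n) (y y' : Balaban1983to89.Site P 0) :
    |-(t * (supDist x y : ℝ) / n) - -(t * (supDist x y' : ℝ) / n)| ≤ t * (supDist y y' : ℝ) / n := by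
  have e : -(t * (supDist x y : ℝ) / n) - -(t * (supDist x y' : ℝ) / n) = (t / n) * ((supDist x y' : ℝ) - (supDist x y : ℝ)) := by ring
  rw [e, abs_mul, abs_of_nonneg (div_nonneg ht hn.le)]
  calc t / n * |(supDist x y' : ℝ) - (supDist x y : ℝ)| ≤ t / n * (supDist y y' : ℝ) :=
        mul_le_mul_of_nonneg_left (by rw [abs_sub_comm]; exact abs_supDist_sub_le x y y') (div_nonneg ht hn.le)
    _ = t * (supDist y y' : ℝ) / n := by ring

/-! ## §3 The Agmon bound for `N(u)`-harmonic functions in the constants of record (k-uniform form) -/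

/-- kernel: `α_k·ε²·(L^k)² = a_k` (`α_k = a_k(L^kε)^{−2}`). [cite: Balaban1982Higgs1, (2.20) p.610] -/
private theorem alpha_mul_eps_sq (a : ℝ) (k : ℕ) :
    B1RG242Torus.α P a k * (P.eps ^ 2 * ((P.L : ℝ) ^ k) ^ 2) = B1.aSeq a P.L k := by
  have hε : P.eps ≠ 0 := P.eps_pos.ne'
  have hL : (P.L : ℝ) ^ k ≠ 0 := pow_ne_zero _ P.cast_L_pos.ne'
  rw [B1RG242Torus.α]
  unfold Params.spacing
  field_simp

open BIJ85ScalarPropagatorTorus BIJ85ScalarPropagatorTorusK in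
open BIJ85ScalarForm464 (opT) in
/-- **THE AGMON BOUND FOR `N(u)`-HARMONIC FUNCTIONS, k-UNIFORM FORM** (sibling `BIJ85SmallFieldHarmonicAgmon.agmon_harmonic` for p31's
whole-torus operator `N(u) = nOp (α_kL^{kd}) ε⁻¹ u k T` through the bridge `BIJ88NeumannPropagatorWholeTorus.opT_eq_nLin`, with the
constants of record `c = ε⁻¹`, `a′ = α_kL^{kd}`, `ℓ = L^k` inserted: `m₀ = (L^kε)^{−2}min(a_k/2, 1/4)`, the defect coefficient
`e^{2t}(L^kε)^{−2}(2d + a_k)`, `a(1 − L^{−2}) < a_k ≤ a`): under plaquette smallness `2d³(L^{2k}θ)² ≤ 1`, for a `1/L^k`-Lipschitz cutoff `η`,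
a `t/L^k`-Lipschitz tilt `g`, a set `S` carrying the block-scale oscillation of `η`, `ψ` with `(N(u)ψ)(y) = 0` off `{η = 0}`, and
`t²(2d + a)e^{2t} ≤ m_*/2`, `m_* = min(a(1 − L^{−2})/2, 1/4)`:
`Σ_y(η(y)e^{g(y)})²‖ψ(y)‖² ≤ (2e^{2t}(2d + a)/m_*)·Σ_{y∈S}e^{2g(y)}‖ψ(y)‖²` — no power of the lattice spacing survives.
[cite: BalabanImbrieJaffe1985, (4.6.2) p.313, (7.3.1) p.326] [cite: Balaban1983RegularityDecay, Theorem p.573 (1.11)–(1.12)] -/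
theorem agmon_step {a : ℝ} (ha : 0 < a) {k : ℕ} (hk1 : 1 ≤ k) (hk : k ≤ P.m + P.K) (U : GaugeField P 0 U1) {θ : ℝ}
    (hθ : ∀ (x : Balaban1983to89.Site P 0) (μ ν : Fin P.d), ‖BIJ85AbelianStokes.plaqC U x μ ν - 1‖ ≤ θ)
    (hsmall : 2 * (P.d : ℝ) ^ 3 * (((P.L : ℝ) ^ k) ^ 2 * θ) ^ 2 ≤ 1)
    (ψ : Balaban1983to89.Site P 0 → ℂ) (η g : Balaban1983to89.Site P 0 → ℝ) {t : ℝ} (ht : 0 ≤ t)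
    (hηL : ∀ y y', |η y - η y'| ≤ (supDist y y' : ℝ) / (P.L : ℝ) ^ k)
    (hg : ∀ y y', |g y - g y'| ≤ t * (supDist y y' : ℝ) / (P.L : ℝ) ^ k)
    (S : Finset (Balaban1983to89.Site P 0)) (hS : ∀ y y', supDist y y' ≤ P.L ^ k → η y ≠ η y' → y ∈ S)
    (hT : ∀ y, η y ≠ 0 → (nOp (B1RG242Torus.α P a k * (P.L : ℝ) ^ (k * P.d)) P.eps⁻¹ U k univ *ᵥ ψ) y = 0)
    (htu : t ^ 2 * (2 * P.d + a) * Real.exp (2 * t) ≤ min (a * (1 - ((P.L : ℝ) ^ 2)⁻¹) / 2) (1 / 4) / 2) :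
    ∑ y, (η y * Real.exp (g y)) ^ 2 * ‖ψ y‖ ^ 2 ≤
      (2 * Real.exp (2 * t) * (2 * P.d + a) / min (a * (1 - ((P.L : ℝ) ^ 2)⁻¹) / 2) (1 / 4)) * ∑ y ∈ S, Real.exp (2 * g y) * ‖ψ y‖ ^ 2 := by
  have hk0 : 0 + k ≤ P.m + P.K := by omega
  have hL1 : (1 : ℝ) < P.L := B1RG242Torus.one_lt_cast_L P
  have hα : 0 < B1RG242Torus.α P a k := mul_pos (B1.aSeq_pos ha hL1 hk1) (inv_pos.2 (pow_pos (P.spacing_pos k) 2))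
  have ha' : 0 < B1RG242Torus.α P a k * (P.L : ℝ) ^ (k * P.d) := mul_pos hα (pow_pos P.cast_L_pos _)
  have haS : B1.aSeq a P.L k ≤ a := B1.aSeq_le ha hL1 k hk1
  have haSlo : a * (1 - ((P.L : ℝ) ^ 2)⁻¹) < B1.aSeq a P.L k := B1.ainf_lt_aSeq ha hL1 k hk1
  have hn0 : (0 : ℝ) < (P.L : ℝ) ^ k := pow_pos P.cast_L_pos k
  have hN0 : (0 : ℝ) < (P.L : ℝ) ^ (k * P.d) := pow_pos P.cast_L_pos _
  have hε : 0 < P.eps := P.eps_pos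
  have hd1 : (1 : ℝ) ≤ P.d := by exact_mod_cast P.hd
  -- `m_* ≤ 1/4`, `m_* ≤ a(1−L⁻²)/2 < a_k/2`, `0 < m_*`
  set mlo : ℝ := min (a * (1 - ((P.L : ℝ) ^ 2)⁻¹) / 2) (1 / 4) with hmlo
  have hinf0 : 0 < a * (1 - ((P.L : ℝ) ^ 2)⁻¹) := by
    have : ((P.L : ℝ) ^ 2)⁻¹ < 1 := inv_lt_one_of_one_lt₀ (by nlinarith)
    exact mul_pos ha (by linarith)
  have hmlo0 : 0 < mlo := lt_min (by linarith) (by norm_num)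
  have hmlo4 : mlo ≤ 1 / 4 := min_le_right _ _
  have hmloa : mlo ≤ B1.aSeq a P.L k / 2 := (min_le_left _ _).trans (by linarith)
  set q : ℝ := P.eps ^ 2 * ((P.L : ℝ) ^ k) ^ 2 with hq
  have hq0 : 0 < q := by positivity
  have hαq : B1RG242Torus.α P a k * q = B1.aSeq a P.L k := alpha_mul_eps_sq a k
  -- the harmonic hypothesis in p11's language
  set φ : FineSp P 0 := WithLp.toLp 2 ψ with hφ
  have hT' : ∀ y, η y ≠ 0 → opT (Dlin P.eps⁻¹ U) (QlinK U k) (B1RG242Torus.α P a k * (P.L : ℝ) ^ (k * P.d)) φ y = 0 := by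
    intro y hy
    rw [BIJ88NeumannPropagatorWholeTorus.opT_eq_nLin]
    show (WithLp.ofLp (BIJ88NeumannPropagatorWholeTorus.nLin (B1RG242Torus.α P a k * (P.L : ℝ) ^ (k * P.d)) P.eps⁻¹ U k φ)) y = 0
    rw [BIJ88NeumannPropagatorWholeTorus.ofLp_nLin, hφ, WithLp.ofLp_toLp]
    exact hT y hy
  -- the lower bound of the coercivity constant: `m_*/q ≤ m₀`
  have hm₀ : mlo / q ≤ min (B1RG242Torus.α P a k * (P.L : ℝ) ^ (k * P.d) / 2)
      (P.eps⁻¹ ^ 2 * (P.L : ℝ) ^ (k * P.d) / (4 * ((P.L : ℝ) ^ k) ^ 2)) / (P.L : ℝ) ^ (k * P.d) := by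
    rw [le_div_iff₀ hN0]
    refine le_min ?_ ?_
    · -- `m_*/q·N ≤ a_kN/(2q) = αN/2`
      have h1 : mlo / q * (P.L : ℝ) ^ (k * P.d) ≤ B1.aSeq a P.L k / 2 / q * (P.L : ℝ) ^ (k * P.d) :=
        mul_le_mul_of_nonneg_right (div_le_div_of_nonneg_right hmloa hq0.le) hN0.le
      refine h1.trans (le_of_eq ?_)
      rw [← hαq]; field_simp
    · have h1 : mlo / q * (P.L : ℝ) ^ (k * P.d) ≤ 1 / 4 / q * (P.L : ℝ) ^ (k * P.d) :=
        mul_le_mul_of_nonneg_right (div_le_div_of_nonneg_right hmlo4 hq0.le) hN0.le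
      refine h1.trans (le_of_eq ?_)
      rw [hq]; field_simp
  -- the tilt condition of record
  have hκ : (2 * P.d * P.eps⁻¹ ^ 2 * (t / (P.L : ℝ) ^ k) ^ 2 +
      B1RG242Torus.α P a k * (P.L : ℝ) ^ (k * P.d) * ((P.L : ℝ) ^ (k * P.d))⁻¹ * t ^ 2) * Real.exp (2 * t) ≤
      min (B1RG242Torus.α P a k * (P.L : ℝ) ^ (k * P.d) / 2)
        (P.eps⁻¹ ^ 2 * (P.L : ℝ) ^ (k * P.d) / (4 * ((P.L : ℝ) ^ k) ^ 2)) / (P.L : ℝ) ^ (k * P.d) / 2 := by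
    have e : 2 * P.d * P.eps⁻¹ ^ 2 * (t / (P.L : ℝ) ^ k) ^ 2 +
        B1RG242Torus.α P a k * (P.L : ℝ) ^ (k * P.d) * ((P.L : ℝ) ^ (k * P.d))⁻¹ * t ^ 2 =
        t ^ 2 * (2 * P.d + B1.aSeq a P.L k) / q := by
      rw [← hαq, hq]; field_simp
    rw [e]
    have h1 : t ^ 2 * (2 * P.d + B1.aSeq a P.L k) / q * Real.exp (2 * t) ≤ t ^ 2 * (2 * P.d + a) * Real.exp (2 * t) / q := by
      rw [div_mul_eq_mul_div]
      refine div_le_div_of_nonneg_right (mul_le_mul_of_nonneg_right ?_ (Real.exp_pos _).le) hq0.le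
      exact mul_le_mul_of_nonneg_left (by linarith) (sq_nonneg _)
    have h2 : t ^ 2 * (2 * P.d + a) * Real.exp (2 * t) / q ≤ mlo / 2 / q := div_le_div_of_nonneg_right htu hq0.le
    have h3 : mlo / 2 / q = mlo / q / 2 := by ring
    linarith [hm₀]
  have hag := agmon_harmonic (j := 0) hk0 P.eps⁻¹ ha' U hθ hsmall φ η g hn0 ht hηL hg S hS hT' hκ
  -- read it back on `ψ`
  have hX : ∑ y, (η y * Real.exp (g y)) ^ 2 * ‖φ y‖ ^ 2 = ∑ y, (η y * Real.exp (g y)) ^ 2 * ‖ψ y‖ ^ 2 := rfl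
  have hY : ∑ y ∈ S, Real.exp (2 * g y) * ‖φ y‖ ^ 2 = ∑ y ∈ S, Real.exp (2 * g y) * ‖ψ y‖ ^ 2 := rfl
  rw [hX, hY] at hag
  set X := ∑ y, (η y * Real.exp (g y)) ^ 2 * ‖ψ y‖ ^ 2 with hXdef
  set Y := ∑ y ∈ S, Real.exp (2 * g y) * ‖ψ y‖ ^ 2 with hYdef
  have hX0 : 0 ≤ X := sum_nonneg fun _ _ => by positivity
  have hY0 : 0 ≤ Y := sum_nonneg fun _ _ => by positivity
  -- the defect coefficient of record
  have hcoef : Real.exp (2 * t) * ((P.L : ℝ) ^ k)⁻¹ ^ 2 *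
      (2 * P.d * P.eps⁻¹ ^ 2 + B1RG242Torus.α P a k * (P.L : ℝ) ^ (k * P.d) * ((P.L : ℝ) ^ (k * P.d))⁻¹ * ((P.L : ℝ) ^ k) ^ 2) =
      Real.exp (2 * t) * (2 * P.d + B1.aSeq a P.L k) / q := by
    rw [← hαq, hq]; field_simp
  rw [hcoef] at hag
  -- `(m_*/(2q))·X ≤ (m₀/2)·X ≤ e^{2t}(2d + a_k)/q·Y ≤ e^{2t}(2d + a)/q·Y`
  have h1 : mlo / q / 2 * X ≤ Real.exp (2 * t) * (2 * P.d + a) / q * Y := by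
    calc mlo / q / 2 * X ≤ _ * X := mul_le_mul_of_nonneg_right (by linarith [hm₀]) hX0
      _ ≤ Real.exp (2 * t) * (2 * P.d + B1.aSeq a P.L k) / q * Y := hag
      _ ≤ Real.exp (2 * t) * (2 * P.d + a) / q * Y := by
          refine mul_le_mul_of_nonneg_right (div_le_div_of_nonneg_right ?_ hq0.le) hY0
          exact mul_le_mul_of_nonneg_left (by linarith) (Real.exp_pos _).le
  -- clear `q`
  have h2 : mlo * X ≤ 2 * Real.exp (2 * t) * (2 * P.d + a) * Y := by
    have := mul_le_mul_of_nonneg_left h1 (by positivity : (0 : ℝ) ≤ 2 * q)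
    have e1 : 2 * q * (mlo / q / 2 * X) = mlo * X := by field_simp
    have e2 : 2 * q * (Real.exp (2 * t) * (2 * P.d + a) / q * Y) = 2 * Real.exp (2 * t) * (2 * P.d + a) * Y := by field_simp
    rw [e1, e2] at this; exact this
  rw [div_mul_eq_mul_div, le_div_iff₀ hmlo0]
  linarith

/-! ## §4 Kernel lemmas of the assembly -/

section Assembly

open BIJ88DeltaLoc234Torus (mulOp nOp_gaugeAct conjTranspose_mul_mulOp)

/-- kernel: **gauge covariance of the whole-torus operator on vectors**: `N(u^h)(h·w) = h·(N(u)w)` ((2.7): `N(u^h) = M_hN(u)M_hᴴ`).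
[cite: BalabanImbrieJaffe1985, (2.7) p.303] -/
theorem nOp_gaugeAct_mulVec_smul {k : ℕ} (hk : 0 + k ≤ P.m + P.K) (a c : ℝ) (h : GaugeTransf P 0 U1) (U : GaugeField P 0 U1)
    (w : Balaban1983to89.Site P 0 → ℂ) :
    nOp a c (GaugeField.gaugeAct h U) k univ *ᵥ (fun z => toC (h z) * w z) = fun z => toC (h z) * (nOp a c U k univ *ᵥ w) z := by
  have e1 : (fun z => toC (h z) * w z) = mulOp h *ᵥ w := by funext z; rw [mulOp, mulVec_diagonal]
  have e2 : (fun z => toC (h z) * (nOp a c U k univ *ᵥ w) z) = mulOp h *ᵥ (nOp a c U k univ *ᵥ w) := by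
    funext z; rw [mulOp, mulVec_diagonal]
  rw [e1, e2, nOp_gaugeAct hk, mulVec_mulVec, mulVec_mulVec, Matrix.mul_assoc (mulOp h * nOp a c U k univ), conjTranspose_mul_mulOp,
    Matrix.mul_one]

/-- kernel: **the torus is bounded**: `|x − y|_∞ ≤ (sites per direction)/2` (each circular coordinate distance is `≤ |T|/2`). [cite: Balaban1982Higgs1, (1.3) p.604] -/
theorem supDist_le_half (x y : Balaban1983to89.Site P 0) : supDist x y ≤ P.sitesPerDir 0 / 2 := by
  rw [B3TorusRadialSums.supDist_eq_sup_cdist]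
  refine Finset.sup_le fun μ _ => ?_
  rw [← BIJ85TorusTentCutoff.natAbs_valMinAbs_eq_cdist]
  exact ZMod.natAbs_valMinAbs_le _

/-- kernel: **the exponent budget** (pure real arithmetic): with `δ₁ = min(t/4, δ₀/2)`, `D ≤ T + D′`, `D_f ≤ D′ + c₁`, `D_b ≤ T + c₁`,
`c₁ ≤ 4n`: `e^{−2tT/n}·(e^{−δ₀D′/n})² ≤ e^{2t+4δ₀}·(e^{−δ₁D/n}e^{−δ₁(D_b+D_f)/n})²·e^{−tT/n}`. [folklore] -/
private theorem exp_budget {n t δ₀ T D' D Db Df c₁ : ℝ} (hn : 0 < n) (ht : 0 ≤ t) (hδ₀ : 0 ≤ δ₀) (hT : 0 ≤ T) (hD' : 0 ≤ D')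
    (hc₁ : 0 ≤ c₁) (h1 : D ≤ T + D') (h2 : Df ≤ D' + c₁) (h3 : Db ≤ T + c₁) (hc : c₁ ≤ 4 * n) :
    Real.exp (2 * -(t * T / n)) * Real.exp (-(δ₀ * (n⁻¹ * D'))) ^ 2 ≤
      Real.exp (2 * t + 4 * δ₀) * (Real.exp (-(min (t / 4) (δ₀ / 2) * (n⁻¹ * D))) *
        Real.exp (-(min (t / 4) (δ₀ / 2) * (n⁻¹ * (Db + Df))))) ^ 2 * Real.exp (-(t * T / n)) := by
  set e : ℝ := min (t / 4) (δ₀ / 2) with he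
  have he0 : 0 ≤ e := le_min (by linarith) (by linarith)
  have het : 2 * e ≤ t / 2 := by have := min_le_left (t / 4) (δ₀ / 2); linarith
  have heδ : 2 * e ≤ δ₀ := by have := min_le_right (t / 4) (δ₀ / 2); linarith
  -- the linear budget, `n`-free numerators
  have p1 : 2 * e * D ≤ 2 * e * (T + D') := mul_le_mul_of_nonneg_left h1 (by linarith)
  have p2 : 2 * e * T ≤ t / 2 * T := mul_le_mul_of_nonneg_right het hT
  have p3 : 2 * e * D' ≤ δ₀ * D' := mul_le_mul_of_nonneg_right heδ hD'
  have p4 : 2 * e * Db ≤ 2 * e * (T + c₁) := mul_le_mul_of_nonneg_left h3 (by linarith)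
  have p5 : 2 * e * c₁ ≤ t / 2 * c₁ := mul_le_mul_of_nonneg_right het hc₁
  have p6 : t / 2 * c₁ ≤ t / 2 * (4 * n) := mul_le_mul_of_nonneg_left hc (by linarith)
  have p7 : 2 * e * Df ≤ 2 * e * (D' + c₁) := mul_le_mul_of_nonneg_left h2 (by linarith)
  have p8 : 2 * e * c₁ ≤ δ₀ * c₁ := mul_le_mul_of_nonneg_right heδ hc₁
  have p9 : δ₀ * c₁ ≤ δ₀ * (4 * n) := mul_le_mul_of_nonneg_left hc hδ₀
  have key : -(2 * t * T) - 2 * δ₀ * D' ≤ (2 * t + 4 * δ₀) * n - 2 * e * D - 2 * e * (Db + Df) - t * T := by nlinarith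
  have hA : Real.exp (2 * -(t * T / n)) * Real.exp (-(δ₀ * (n⁻¹ * D'))) ^ 2 =
      Real.exp ((-(2 * t * T) - 2 * δ₀ * D') / n) := by
    rw [← Real.exp_nat_mul, ← Real.exp_add]; congr 1; push_cast; field_simp; ring
  have hB : Real.exp (2 * t + 4 * δ₀) * (Real.exp (-(e * (n⁻¹ * D))) * Real.exp (-(e * (n⁻¹ * (Db + Df))))) ^ 2 *
      Real.exp (-(t * T / n)) = Real.exp (((2 * t + 4 * δ₀) * n - 2 * e * D - 2 * e * (Db + Df) - t * T) / n) := by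
    rw [← Real.exp_add, ← Real.exp_nat_mul, ← Real.exp_add, ← Real.exp_add]; congr 1; push_cast; field_simp; ring
  rw [hA, hB]
  exact Real.exp_le_exp.2 (div_le_div_of_nonneg_right key hn.le)

/-- kernel: the square-root step of the conclusion (pure real arithmetic): `S ≤ A²BN`, `p√N ≤ 2C√S` (`A, B, C ≥ 0`, `N > 0`) ⟹
`p ≤ 2CA√B`. [folklore] -/
private theorem sqrt_step {S A B N p C : ℝ} (hA : 0 ≤ A) (hB : 0 ≤ B) (hN : 0 < N) (hC : 0 ≤ C) (hS : S ≤ A ^ 2 * B * N)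
    (hp : p * Real.sqrt N ≤ 2 * C * Real.sqrt S) : p ≤ 2 * C * A * Real.sqrt B := by
  have hsN : 0 < Real.sqrt N := Real.sqrt_pos.2 hN
  have h1 : Real.sqrt S ≤ A * Real.sqrt B * Real.sqrt N := by
    calc Real.sqrt S ≤ Real.sqrt (A ^ 2 * B * N) := Real.sqrt_le_sqrt hS
      _ = A * Real.sqrt B * Real.sqrt N := by
          rw [Real.sqrt_mul (by positivity), Real.sqrt_mul (by positivity), Real.sqrt_sq hA]
  have h2 : p * Real.sqrt N ≤ (2 * C * A * Real.sqrt B) * Real.sqrt N := by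
    calc p * Real.sqrt N ≤ 2 * C * Real.sqrt S := hp
      _ ≤ 2 * C * (A * Real.sqrt B * Real.sqrt N) := mul_le_mul_of_nonneg_left h1 (by positivity)
      _ = (2 * C * A * Real.sqrt B) * Real.sqrt N := by ring
  exact le_of_mul_le_mul_right h2 hsN

/-- kernel: `e² < 8`. [folklore] -/
private theorem exp_two_lt_eight : Real.exp 2 < 8 := by
  have h := Real.exp_one_lt_d9
  have e : Real.exp 2 = Real.exp 1 * Real.exp 1 := by rw [← Real.exp_add]; norm_num
  rw [e]; nlinarith [Real.exp_pos 1]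

/-- kernel: **the collar, pointwise**: at a collar site `y` (`δ(y) ≤ 3n + 1`, `δ(y) = |y − w₁|_∞` for some `w₁ ∉ □`) a function `v`
obeying the two-member bound `‖v(y)‖ ≤ 2s·c₀Fe^{−δ₀D′/n}` for every admissible `D′ ≤ dist(y, supp f)` has tilted mass
`e^{−2t|x−y|/n}‖v(y)‖² ≤ (2sc₀F)²e^{2t+4δ₀}·(e^{−δ₁D/n}e^{−δ₁(D_b+D_f)/n})²·e^{−t|x−y|/n}`, `δ₁ = min(t/4, δ₀/2)` (the admissible
`D′ = max(D_f − 3n − 1, D − |x − y|, 0)` and the exponent budget). [cite: Balaban1983RegularityDecay, Theorem p.573 (1.12)] -/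
private theorem collar_pointwise {k : ℕ} (hk1 : 1 ≤ k) {B : Finset (Balaban1983to89.Site P 0)} {δ : Balaban1983to89.Site P 0 → ℕ}
    (h2 : ∀ y, ∃ w, w ∉ B ∧ δ y = supDist y w) {x y : Balaban1983to89.Site P 0}
    (hy3n : δ y ≤ 3 * P.L ^ k + 1) (f : Balaban1983to89.Site P 0 → ℂ) {F D Db Df c₀ δ₀ t s : ℝ} (hδ₀ : 0 ≤ δ₀) (ht : 0 ≤ t)
    (hsuppD : ∀ y', f y' ≠ 0 → D ≤ (supDist x y' : ℝ)) (hsuppDb : ∀ w, w ∉ B → Db ≤ (supDist x w : ℝ))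
    (hsuppDf : ∀ y', f y' ≠ 0 → ∀ w, w ∉ B → Df ≤ (supDist y' w : ℝ)) (v : Balaban1983to89.Site P 0 → ℂ)
    (hvD : ∀ D' : ℝ, 0 ≤ D' → (∀ y', f y' ≠ 0 → D' ≤ (supDist y y' : ℝ)) →
      ‖v y‖ ≤ 2 * s * c₀ * F * Real.exp (-(δ₀ * (((P.L : ℝ) ^ k)⁻¹ * D')))) :
    Real.exp (2 * -(t * (supDist x y : ℝ) / (P.L : ℝ) ^ k)) * ‖v y‖ ^ 2 ≤
      (2 * s * c₀ * F) ^ 2 * Real.exp (2 * t + 4 * δ₀) *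
        (Real.exp (-(min (t / 4) (δ₀ / 2) * (((P.L : ℝ) ^ k)⁻¹ * D))) *
          Real.exp (-(min (t / 4) (δ₀ / 2) * (((P.L : ℝ) ^ k)⁻¹ * (Db + Df))))) ^ 2 *
        Real.exp (-(t * (supDist x y : ℝ) / (P.L : ℝ) ^ k)) := by
  have hn0 : (0 : ℝ) < (P.L : ℝ) ^ k := pow_pos P.cast_L_pos k
  have hr2 : 2 ≤ P.L ^ k := Nat.one_lt_pow (by omega) P.hL.2
  have hn2 : (2 : ℝ) ≤ (P.L : ℝ) ^ k := by exact_mod_cast hr2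
  obtain ⟨w₁, hw₁, hδy⟩ := h2 y
  have hδy' : (supDist y w₁ : ℝ) ≤ 3 * (P.L : ℝ) ^ k + 1 := by rw [← hδy]; exact_mod_cast hy3n
  -- the admissible distance
  set D' : ℝ := max (max (Df - (3 * (P.L : ℝ) ^ k + 1)) (D - (supDist x y : ℝ))) 0 with hD'
  have hD'0 : 0 ≤ D' := le_max_right _ _
  have hD'supp : ∀ y', f y' ≠ 0 → D' ≤ (supDist y y' : ℝ) := by
    intro y' hy'
    refine max_le (max_le ?_ ?_) (Nat.cast_nonneg _)
    · have hh := hsuppDf y' hy' w₁ hw₁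
      have htri : (supDist y' w₁ : ℝ) ≤ supDist y' y + supDist y w₁ := by exact_mod_cast supDist_triangle y' y w₁
      have hsy : (supDist y' y : ℝ) = supDist y y' := by rw [supDist_comm]
      linarith
    · have hh := hsuppD y' hy'
      have htri : (supDist x y' : ℝ) ≤ supDist x y + supDist y y' := by exact_mod_cast supDist_triangle x y y'
      linarith
  have hvy := hvD D' hD'0 hD'supp
  have hvy2 : ‖v y‖ ^ 2 ≤ (2 * s * c₀ * F) ^ 2 * Real.exp (-(δ₀ * (((P.L : ℝ) ^ k)⁻¹ * D'))) ^ 2 := by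
    rw [← mul_pow]; exact pow_le_pow_left₀ (norm_nonneg _) hvy 2
  -- the geometric hypotheses of the budget
  have hgeo1 : D ≤ (supDist x y : ℝ) + D' := by
    have : D - (supDist x y : ℝ) ≤ D' := (le_max_right _ _).trans (le_max_left _ _); linarith
  have hgeo2 : Df ≤ D' + (3 * (P.L : ℝ) ^ k + 1) := by
    have : Df - (3 * (P.L : ℝ) ^ k + 1) ≤ D' := (le_max_left _ _).trans (le_max_left _ _); linarith
  have hgeo3 : Db ≤ (supDist x y : ℝ) + (3 * (P.L : ℝ) ^ k + 1) := by
    have hh := hsuppDb w₁ hw₁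
    have htri : (supDist x w₁ : ℝ) ≤ supDist x y + supDist y w₁ := by exact_mod_cast supDist_triangle x y w₁
    linarith
  have hbud := exp_budget hn0 ht hδ₀ (Nat.cast_nonneg _) hD'0 (by positivity) hgeo1 hgeo2 hgeo3 (by linarith)
  calc Real.exp (2 * -(t * (supDist x y : ℝ) / (P.L : ℝ) ^ k)) * ‖v y‖ ^ 2
      ≤ Real.exp (2 * -(t * (supDist x y : ℝ) / (P.L : ℝ) ^ k)) *
          ((2 * s * c₀ * F) ^ 2 * Real.exp (-(δ₀ * (((P.L : ℝ) ^ k)⁻¹ * D'))) ^ 2) :=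
        mul_le_mul_of_nonneg_left hvy2 (Real.exp_pos _).le
    _ = (2 * s * c₀ * F) ^ 2 * (Real.exp (2 * -(t * (supDist x y : ℝ) / (P.L : ℝ) ^ k)) *
          Real.exp (-(δ₀ * (((P.L : ℝ) ^ k)⁻¹ * D'))) ^ 2) := by ring
    _ ≤ (2 * s * c₀ * F) ^ 2 * (Real.exp (2 * t + 4 * δ₀) *
        (Real.exp (-(min (t / 4) (δ₀ / 2) * (((P.L : ℝ) ^ k)⁻¹ * D))) *
          Real.exp (-(min (t / 4) (δ₀ / 2) * (((P.L : ℝ) ^ k)⁻¹ * (Db + Df))))) ^ 2 *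
        Real.exp (-(t * (supDist x y : ℝ) / (P.L : ℝ) ^ k))) :=
        mul_le_mul_of_nonneg_left hbud (sq_nonneg _)
    _ = _ := by ring

/-- kernel: **the mass near `x`**: where `η = 1` and `2g ≥ −14t`, `Σ_{ball}‖v‖² ≤ e^{14t}Σ_y(ηe^g)²‖v‖²`. [folklore] -/
private theorem ball_mass_le (x : Balaban1983to89.Site P 0) (R : ℕ) (v : Balaban1983to89.Site P 0 → ℂ)
    (η g : Balaban1983to89.Site P 0 → ℝ) {t : ℝ} (hη1 : ∀ y, supDist x y ≤ R → η y = 1)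
    (hg : ∀ y, supDist x y ≤ R → -(14 * t) ≤ 2 * g y) :
    ∑ y ∈ ball x R, ‖v y‖ ^ 2 ≤ Real.exp (14 * t) * ∑ y, (η y * Real.exp (g y)) ^ 2 * ‖v y‖ ^ 2 := by
  have hpt : ∀ y ∈ ball x R, ‖v y‖ ^ 2 ≤ Real.exp (14 * t) * ((η y * Real.exp (g y)) ^ 2 * ‖v y‖ ^ 2) := by
    intro y hy
    rw [mem_ball] at hy
    have hexp : 1 ≤ Real.exp (14 * t) * Real.exp (g y) ^ 2 := by
      rw [← Real.exp_nat_mul, ← Real.exp_add]; push_cast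
      exact Real.one_le_exp (by linarith [hg y hy])
    rw [hη1 y hy, one_mul]
    calc ‖v y‖ ^ 2 = 1 * ‖v y‖ ^ 2 := (one_mul _).symm
      _ ≤ (Real.exp (14 * t) * Real.exp (g y) ^ 2) * ‖v y‖ ^ 2 := mul_le_mul_of_nonneg_right hexp (sq_nonneg _)
      _ = _ := by ring
  calc ∑ y ∈ ball x R, ‖v y‖ ^ 2 ≤ ∑ y ∈ ball x R, Real.exp (14 * t) * ((η y * Real.exp (g y)) ^ 2 * ‖v y‖ ^ 2) := Finset.sum_le_sum hpt
    _ = Real.exp (14 * t) * ∑ y ∈ ball x R, (η y * Real.exp (g y)) ^ 2 * ‖v y‖ ^ 2 := by rw [Finset.mul_sum]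
    _ ≤ Real.exp (14 * t) * ∑ y, (η y * Real.exp (g y)) ^ 2 * ‖v y‖ ^ 2 :=
        mul_le_mul_of_nonneg_left (Finset.sum_le_sum_of_subset_of_nonneg (Finset.subset_univ _) fun _ _ _ => by positivity)
          (Real.exp_pos _).le

end Assembly

/-! ## §5 [Balaban1983RegularityDecay] (1.11)–(1.12) AT SMALL NON-FLAT FIELDS, IN THE (H1.12″) SHAPE OF p31's `opClose231_gen` -/

section Main

open BIJ85CentredAxialGauge (centredGauge dist1_centredGauge_le)

set_option maxHeartbeats 800000 in
/-- **THE `δG_k` VALUE MEMBER AT SMALL NON-FLAT `U(1)` FIELDS, k-UNIFORM, OPERATOR FORM** — [Balaban1983RegularityDecay] Theorem p. 573: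
*"If Ω ⊂ Ω₀, then for δG_k(Ω,Ω₀,A) = G_k(Ω,A) − G_k(Ω₀,A), (1.11) we have the inequalities (1.5) and (1.6) [= (1.9), (1.10)] (with the same
restrictions on x, x′) with the additional factor (1.12) [= exp(−δ₀dist(x, Ω^c))exp(−δ₀dist(supp f, Ω^c))] on the right hand sides"*, for
[BalabanImbrieJaffe1985] p. 326 *"The propagators arising from Δ_k(u_k) … also satisfy the regularity and decay estimates of [7]"*, here for
p31's region Neumann propagators `G_k(X,u) = gBox (α_kL^{kd}) ε⁻¹ u k X` on NESTED k-BLOCK UNIONS `□ ⊆ Ω` of the torus, in the binder shape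
(H1.12″) = hypothesis `hC` of `BIJ88DeltaLocClose235General.opClose231_gen` (rows `x ∈ □` at sup-depth `≥ 10L^k` below `T ∖ □`;
`F = ‖f‖_∞`, `D ≤ dist(x, supp f)`, `D_b ≤ dist(x, □^c)`, `D_f ≤ dist(supp f, □^c)`, bound `(L^kε)²·c₁e^{−δ₁D/L^k}e^{−δ₁(D_b+D_f)/L^k}F`),
FROM the (H1.10″) value members of `G_k(□,u)` and `G_k(Ω,u)` on the rows of `□` (hypotheses; p27's torus/cube members and p34's region
member instantiate them) and block-scale plaquette smallness `|u(∂p) − 1| ≤ θ`, `2d³(L^{2k}θ)² ≤ 1`: for `2 ≤ d ≤ 3`, `L` odd `> 1`, `a > 0`,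
`c₀ ≥ 0`, `δ₀ > 0` there are `c₁, δ₁ > 0` depending on `(d, L, a, c₀, δ₀)` only.  METHOD (ours — the print extends [7]'s random-walk
expansion): `v = G_k(□)f − G_k(Ω)f` is `N(u)`-harmonic on the interior of `□` (§1); the Agmon bound of sibling 1 with the collar cutoff
and the tilt `e^{−t|x−·|_∞/L^k}` (§2–§3) bounds the tilted `ℓ²` mass of `v` by its mass on the collar `{3 ≤ depth ≤ 3L^k+1}`, where the two
(H1.10″) members bound `v` pointwise; the local mean-value inequality of sibling 2 in the centred axial gauge around `x`
(`BIJ85CentredAxialGauge`, `|u′ − 1| ≤ (d−1)θ|x − ·|_∞`, `(d−1)θL^{2k} ≤ 1`) converts the `ℓ²` mass near `x` into the value at `x`.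
[cite: Balaban1983RegularityDecay, Theorem p.573 (1.11)–(1.12)] [cite: BalabanImbrieJaffe1985, (7.3.1) p.326, (4.6.2) p.313]
[cite: BalabanImbrieJaffe1988, (2.31) p.263] -/
theorem close112_smallField_of_inputs (d L : ℕ) (hd : 2 ≤ d) (hd3 : d ≤ 3) (hL : Odd L ∧ 1 < L) {a : ℝ} (ha : 0 < a)
    {c₀ δ₀ : ℝ} (hc₀ : 0 ≤ c₀) (hδ₀ : 0 < δ₀) :
    ∃ c₁ δ₁ : ℝ, 0 < c₁ ∧ 0 < δ₁ ∧ ∀ (P : Params), P.d = d → P.L = L → ∀ k : ℕ, 1 ≤ k → k ≤ P.K →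
      ∀ (U : GaugeField P 0 U1) (θ : ℝ), (∀ (y : Balaban1983to89.Site P 0) (μ ν : Fin P.d), ‖BIJ85AbelianStokes.plaqC U y μ ν - 1‖ ≤ θ) →
      2 * (P.d : ℝ) ^ 3 * (((P.L : ℝ) ^ k) ^ 2 * θ) ^ 2 ≤ 1 →
      ∀ (B Ω : Finset (Balaban1983to89.Site P 0)), IsBlockUnion k B → IsBlockUnion k Ω → B ⊆ Ω →
      (∀ x ∈ B, ∀ (f : Balaban1983to89.Site P 0 → ℂ) (F D : ℝ), (∀ y, ‖f y‖ ≤ F) → 0 ≤ D →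
          (∀ y, f y ≠ 0 → D ≤ B5Ineq137Torus.T P 0 x y) →
          ‖(gBox (B1RG242Torus.α P a k * (P.L : ℝ) ^ (k * P.d)) P.eps⁻¹ U k B *ᵥ f) x‖ ≤
            P.spacing k ^ 2 * (c₀ * Real.exp (-(δ₀ * (((P.L : ℝ) ^ k)⁻¹ * D))) * F)) →
      (∀ x ∈ B, ∀ (f : Balaban1983to89.Site P 0 → ℂ) (F D : ℝ), (∀ y, ‖f y‖ ≤ F) → 0 ≤ D →
          (∀ y, f y ≠ 0 → D ≤ B5Ineq137Torus.T P 0 x y) →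
          ‖(gBox (B1RG242Torus.α P a k * (P.L : ℝ) ^ (k * P.d)) P.eps⁻¹ U k Ω *ᵥ f) x‖ ≤
            P.spacing k ^ 2 * (c₀ * Real.exp (-(δ₀ * (((P.L : ℝ) ^ k)⁻¹ * D))) * F)) →
      ∀ x ∈ B, (∀ w, w ∉ B → 10 * (P.L : ℝ) ^ k ≤ B5Ineq137Torus.T P 0 x w) →
      ∀ (f : Balaban1983to89.Site P 0 → ℂ) (F D Db Df : ℝ), (∀ y, ‖f y‖ ≤ F) → (∀ y, y ∉ B → f y = 0) →
        0 ≤ D → (∀ y, f y ≠ 0 → D ≤ B5Ineq137Torus.T P 0 x y) → 0 ≤ Db → (∀ w, w ∉ B → Db ≤ B5Ineq137Torus.T P 0 x w) →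
        0 ≤ Df → (∀ y, f y ≠ 0 → ∀ w, w ∉ B → Df ≤ B5Ineq137Torus.T P 0 y w) →
        ‖(gBox (B1RG242Torus.α P a k * (P.L : ℝ) ^ (k * P.d)) P.eps⁻¹ U k B *ᵥ f) x -
            (gBox (B1RG242Torus.α P a k * (P.L : ℝ) ^ (k * P.d)) P.eps⁻¹ U k Ω *ᵥ f) x‖ ≤
          P.spacing k ^ 2 * (c₁ * Real.exp (-(δ₁ * (((P.L : ℝ) ^ k)⁻¹ * D))) *
            Real.exp (-(δ₁ * (((P.L : ℝ) ^ k)⁻¹ * (Db + Df)))) * F) := by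
  classical
  obtain ⟨Cmv, hCmv, hmv⟩ := harmonic_meanValue d L hd hd3 hL ha
  -- the tilt rate `t`, from `t²(2d + a)e^{2t} ≤ m_*/2`
  have hL1 : (1 : ℝ) < L := by exact_mod_cast hL.2
  have hinf0 : 0 < a * (1 - ((L : ℝ) ^ 2)⁻¹) := by
    have : ((L : ℝ) ^ 2)⁻¹ < 1 := inv_lt_one_of_one_lt₀ (by nlinarith)
    exact mul_pos ha (by linarith)
  have hmlo0 : 0 < min (a * (1 - ((L : ℝ) ^ 2)⁻¹) / 2) (1 / 4) := lt_min (by linarith) (by norm_num)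
  have hda : (0 : ℝ) < 2 * d + a := by positivity
  obtain ⟨t, ht0, ht1, htu⟩ : ∃ t : ℝ, 0 < t ∧ t ≤ 1 ∧
      t ^ 2 * (2 * d + a) * Real.exp (2 * t) ≤ min (a * (1 - ((L : ℝ) ^ 2)⁻¹) / 2) (1 / 4) / 2 := by
    refine ⟨min 1 (min (a * (1 - ((L : ℝ) ^ 2)⁻¹) / 2) (1 / 4) / (16 * (2 * d + a))), lt_min one_pos (by positivity),
      min_le_left _ _, ?_⟩
    set m := min (a * (1 - ((L : ℝ) ^ 2)⁻¹) / 2) (1 / 4)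
    set t := min 1 (m / (16 * (2 * d + a))) with htdef
    have ht0 : 0 < t := lt_min one_pos (by positivity)
    have ht1 : t ≤ 1 := min_le_left _ _
    have h1 : t ≤ m / (16 * (2 * d + a)) := min_le_right _ _
    have h2 : t ^ 2 ≤ t := by nlinarith
    have h3 : Real.exp (2 * t) ≤ 8 := by
      have := Real.exp_le_exp.2 (show 2 * t ≤ 2 by linarith); linarith [exp_two_lt_eight]
    calc t ^ 2 * (2 * d + a) * Real.exp (2 * t) ≤ t * (2 * d + a) * 8 := by gcongr
      _ ≤ m / (16 * (2 * d + a)) * (2 * d + a) * 8 := by gcongr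
      _ = m / 2 := by field_simp; ring
  -- the constants
  set K₁ : ℝ := 2 * Real.exp (2 * t) * (2 * d + a) / min (a * (1 - ((L : ℝ) ^ 2)⁻¹) / 2) (1 / 4) with hK₁
  have hK₁0 : 0 ≤ K₁ := by positivity
  set Bc : ℝ := Real.exp (14 * t) * K₁ * (2 * (1 + d / t)) ^ d with hBc
  have hBc0 : 0 ≤ Bc := by positivity
  refine ⟨2 * Cmv * (2 * c₀ * Real.exp (t + 2 * δ₀)) * Real.sqrt Bc + 1, min (t / 4) (δ₀ / 2), by positivity,
    lt_min (by linarith) (by linarith), ?_⟩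
  intro P hPd hPL k hk1 hkK U θ hθ hsmall B Ω hB hΩ hsub hGB hGΩ x hxB hdeep f F D Db Df hF _ hD hsuppD hDb hsuppDb hDf hsuppDf
  subst hPd; subst hPL
  -- basic quantities
  have hk : k ≤ P.m + P.K := hkK.trans (Nat.le_add_left _ _)
  have hk0 : 0 + k ≤ P.m + P.K := by omega
  have hr2 : 2 ≤ P.L ^ k := Nat.one_lt_pow (by omega) P.hL.2
  have hncast : ((P.L ^ k : ℕ) : ℝ) = (P.L : ℝ) ^ k := by push_cast; rfl
  have hn0 : (0 : ℝ) < (P.L : ℝ) ^ k := pow_pos P.cast_L_pos k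
  have hn2 : (2 : ℝ) ≤ (P.L : ℝ) ^ k := by exact_mod_cast hr2
  have hα : 0 < B1RG242Torus.α P a k :=
    mul_pos (B1.aSeq_pos ha (B1RG242Torus.one_lt_cast_L P) hk1) (inv_pos.2 (pow_pos (P.spacing_pos k) 2))
  have hA'0 : 0 < B1RG242Torus.α P a k * (P.L : ℝ) ^ (k * P.d) := mul_pos hα (pow_pos P.cast_L_pos _)
  have hc' : P.eps⁻¹ ≠ 0 := inv_ne_zero P.eps_pos.ne'
  have hθ0 : 0 ≤ θ := le_trans (norm_nonneg _) (hθ x 0 0)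
  have hF0 : 0 ≤ F := (norm_nonneg _).trans (hF x)
  have hT : ∀ y z : Balaban1983to89.Site P 0, B5Ineq137Torus.T P 0 y z = (supDist y z : ℝ) :=
    fun y z => B3Bound323ZeroTorus.T_eq_supDist P y z
  -- the function `v` and the target
  set v : Balaban1983to89.Site P 0 → ℂ := fun y => (gBox (B1RG242Torus.α P a k * (P.L : ℝ) ^ (k * P.d)) P.eps⁻¹ U k B *ᵥ f) y -
    (gBox (B1RG242Torus.α P a k * (P.L : ℝ) ^ (k * P.d)) P.eps⁻¹ U k Ω *ᵥ f) y with hv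
  set EXP : ℝ := Real.exp (-(min (t / 4) (δ₀ / 2) * (((P.L : ℝ) ^ k)⁻¹ * D))) *
    Real.exp (-(min (t / 4) (δ₀ / 2) * (((P.L : ℝ) ^ k)⁻¹ * (Db + Df)))) with hEXP
  have hEXP0 : 0 ≤ EXP := by positivity
  show ‖v x‖ ≤ _
  have hgoal : P.spacing k ^ 2 * ((2 * Cmv * (2 * c₀ * Real.exp (t + 2 * δ₀)) * Real.sqrt Bc + 1) *
      Real.exp (-(min (t / 4) (δ₀ / 2) * (((P.L : ℝ) ^ k)⁻¹ * D))) *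
      Real.exp (-(min (t / 4) (δ₀ / 2) * (((P.L : ℝ) ^ k)⁻¹ * (Db + Df)))) * F) =
      P.spacing k ^ 2 * (2 * Cmv * (2 * c₀ * Real.exp (t + 2 * δ₀)) * Real.sqrt Bc + 1) * EXP * F := by rw [hEXP]; ring
  rw [hgoal]
  -- the trivial case `□ = T`
  by_cases hBT : B = univ
  · have hΩT : Ω = univ := Finset.eq_univ_of_forall fun y => hsub (hBT ▸ mem_univ y)
    have h0 : v x = 0 := by
      show (gBox _ _ U k B *ᵥ f) x - (gBox _ _ U k Ω *ᵥ f) x = 0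
      rw [hBT, hΩT, sub_self]
    rw [h0, norm_zero]; positivity
  -- the depth function; the torus is large
  obtain ⟨δ, h1, h2⟩ := exists_depth hBT
  obtain ⟨w₀, hw₀, hδx⟩ := h2 x
  have hδx10 : 10 * P.L ^ k ≤ δ x := by
    have hh := hdeep w₀ hw₀
    rw [hT, ← hδx, ← hncast] at hh
    exact_mod_cast hh
  have hNbig : 4 * P.L ^ k + 7 ≤ P.sitesPerDir 0 := by
    have h3 := supDist_le_half x w₀
    rw [← hδx] at h3
    omega
  -- (1) `v` is harmonic where the depth is `≥ 2`
  have hharm : ∀ y, 2 ≤ δ y → (nOp (B1RG242Torus.α P a k * (P.L : ℝ) ^ (k * P.d)) P.eps⁻¹ U k univ *ᵥ v) y = 0 := by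
    intro y hy
    obtain ⟨hyB, hs, hu⟩ := interior_of_depth_two h1 h2 hy
    exact nOp_univ_diff_apply_eq_zero hk0 hc' hA'0 U hB hΩ hsub f hyB hs hu
  -- (2)–(3) the cutoff, the tilt, the collar set, the Agmon bound
  obtain ⟨-, hηL, hη1, hη0, hηS⟩ := cutoff_props h1 h2 k
  have hSmem : ∀ y, y ∈ (univ.filter fun y : Balaban1983to89.Site P 0 => 3 ≤ δ y ∧ δ y ≤ 3 * P.L ^ k + 1) ↔
      3 ≤ δ y ∧ δ y ≤ 3 * P.L ^ k + 1 := fun y => by rw [Finset.mem_filter]; simp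
  have hag := agmon_step ha hk1 hk U hθ hsmall v (fun y => min 1 (max 0 (((δ y : ℝ) - (P.L : ℝ) ^ k - 2) / (P.L : ℝ) ^ k)))
    (fun y => -(t * (supDist x y : ℝ) / (P.L : ℝ) ^ k)) ht0.le (fun y y' => hηL y y') (fun y y' => tilt_lipschitz x ht0.le hn0 y y')
    (univ.filter fun y => 3 ≤ δ y ∧ δ y ≤ 3 * P.L ^ k + 1) (fun y y' hd hne => (hSmem y).2 (hηS y y' hd hne))
    (fun y hy => hharm y (by by_contra hlt; exact hy (hη0 y (by omega)))) htu
  -- (4)–(5) the collar sum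
  have hsuppD' : ∀ y', f y' ≠ 0 → D ≤ (supDist x y' : ℝ) := fun y' hy' => by rw [← hT]; exact hsuppD y' hy'
  have hsuppDb' : ∀ w, w ∉ B → Db ≤ (supDist x w : ℝ) := fun w hw => by rw [← hT]; exact hsuppDb w hw
  have hsuppDf' : ∀ y', f y' ≠ 0 → ∀ w, w ∉ B → Df ≤ (supDist y' w : ℝ) := fun y' hy' w hw => by rw [← hT]; exact hsuppDf y' hy' w hw
  have hcollar : ∀ y ∈ (univ.filter fun y : Balaban1983to89.Site P 0 => 3 ≤ δ y ∧ δ y ≤ 3 * P.L ^ k + 1),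
      Real.exp (2 * -(t * (supDist x y : ℝ) / (P.L : ℝ) ^ k)) * ‖v y‖ ^ 2 ≤
        (2 * P.spacing k ^ 2 * c₀ * F) ^ 2 * Real.exp (2 * t + 4 * δ₀) * EXP ^ 2 *
          Real.exp (-(t * (supDist x y : ℝ) / (P.L : ℝ) ^ k)) := by
    intro y hyS
    obtain ⟨hy3, hy3n⟩ := (hSmem y).1 hyS
    have hyB : y ∈ B := mem_of_depth_pos h1 (by omega)
    refine collar_pointwise hk1 h2 hy3n f hδ₀.le ht0.le hsuppD' hsuppDb' hsuppDf' v fun D' hD'0 hD'supp => ?_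
    have hD's : ∀ y', f y' ≠ 0 → D' ≤ B5Ineq137Torus.T P 0 y y' := fun y' hy' => by rw [hT]; exact hD'supp y' hy'
    have hGBy := hGB y hyB f F D' hF hD'0 hD's
    have hGΩy := hGΩ y hyB f F D' hF hD'0 hD's
    calc ‖v y‖ ≤ ‖(gBox (B1RG242Torus.α P a k * (P.L : ℝ) ^ (k * P.d)) P.eps⁻¹ U k B *ᵥ f) y‖ +
          ‖(gBox (B1RG242Torus.α P a k * (P.L : ℝ) ^ (k * P.d)) P.eps⁻¹ U k Ω *ᵥ f) y‖ := norm_sub_le _ _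
      _ ≤ _ := add_le_add hGBy hGΩy
      _ = 2 * P.spacing k ^ 2 * c₀ * F * Real.exp (-(δ₀ * (((P.L : ℝ) ^ k)⁻¹ * D'))) := by ring
  have hsumS : ∑ y ∈ (univ.filter fun y : Balaban1983to89.Site P 0 => 3 ≤ δ y ∧ δ y ≤ 3 * P.L ^ k + 1),
      Real.exp (2 * -(t * (supDist x y : ℝ) / (P.L : ℝ) ^ k)) * ‖v y‖ ^ 2 ≤
      (2 * P.spacing k ^ 2 * c₀ * F) ^ 2 * Real.exp (2 * t + 4 * δ₀) * EXP ^ 2 * ((2 * (1 + P.d / t)) ^ P.d * ((P.L : ℝ) ^ k) ^ P.d) := by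
    have hrad : ∑ y ∈ (univ.filter fun y : Balaban1983to89.Site P 0 => 3 ≤ δ y ∧ δ y ≤ 3 * P.L ^ k + 1),
        Real.exp (-(t * (supDist x y : ℝ) / (P.L : ℝ) ^ k)) ≤ (2 * (1 + P.d / t)) ^ P.d * ((P.L : ℝ) ^ k) ^ P.d :=
      (Finset.sum_le_sum_of_subset_of_nonneg (Finset.subset_univ _) fun _ _ _ => (Real.exp_pos _).le).trans
        (BIJ85FreeResolventTiltedRow.sum_exp_neg_supDist_scale_le (P := P) ht0 k x)
    refine (Finset.sum_le_sum hcollar).trans ?_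
    rw [← Finset.mul_sum]
    exact mul_le_mul_of_nonneg_left hrad (by positivity)
  -- (6) the mass near `x`
  have hball := ball_mass_le x (5 * P.L ^ k + 2) v (fun y => min 1 (max 0 (((δ y : ℝ) - (P.L : ℝ) ^ k - 2) / (P.L : ℝ) ^ k)))
    (fun y => -(t * (supDist x y : ℝ) / (P.L : ℝ) ^ k)) (t := t)
    (fun y hy => hη1 y (by have := depth_le_add h1 h2 x y; omega))
    (fun y hy => by
      have h7 : (supDist x y : ℝ) ≤ 7 * (P.L : ℝ) ^ k := by
        have : ((supDist x y : ℕ) : ℝ) ≤ ((5 * P.L ^ k + 2 : ℕ) : ℝ) := by exact_mod_cast hy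
        push_cast at this; linarith
      have : t * (supDist x y : ℝ) / (P.L : ℝ) ^ k ≤ 7 * t := by
        rw [div_le_iff₀ hn0]; nlinarith [ht0.le]
      show -(14 * t) ≤ 2 * -(t * (supDist x y : ℝ) / (P.L : ℝ) ^ k)
      linarith)
  have hS' : ∑ y ∈ ball x (5 * P.L ^ k + 2), ‖v y‖ ^ 2 ≤
      (2 * P.spacing k ^ 2 * c₀ * F * Real.exp (t + 2 * δ₀) * EXP) ^ 2 * Bc * ((P.L : ℝ) ^ k) ^ P.d := by
    have hg2 : ∀ y, Real.exp (2 * -(t * (supDist x y : ℝ) / (P.L : ℝ) ^ k)) =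
        Real.exp (2 * (fun y => -(t * (supDist x y : ℝ) / (P.L : ℝ) ^ k)) y) := fun y => rfl
    calc ∑ y ∈ ball x (5 * P.L ^ k + 2), ‖v y‖ ^ 2 ≤ _ := hball
      _ ≤ Real.exp (14 * t) * (K₁ * ∑ y ∈ (univ.filter fun y : Balaban1983to89.Site P 0 => 3 ≤ δ y ∧ δ y ≤ 3 * P.L ^ k + 1),
            Real.exp (2 * -(t * (supDist x y : ℝ) / (P.L : ℝ) ^ k)) * ‖v y‖ ^ 2) := by
          refine mul_le_mul_of_nonneg_left ?_ (Real.exp_pos _).le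
          rw [hK₁]; exact hag
      _ ≤ Real.exp (14 * t) * (K₁ * ((2 * P.spacing k ^ 2 * c₀ * F) ^ 2 * Real.exp (2 * t + 4 * δ₀) * EXP ^ 2 *
            ((2 * (1 + P.d / t)) ^ P.d * ((P.L : ℝ) ^ k) ^ P.d))) := by gcongr
      _ = (2 * P.spacing k ^ 2 * c₀ * F * Real.exp (t + 2 * δ₀) * EXP) ^ 2 * Bc * ((P.L : ℝ) ^ k) ^ P.d := by
          rw [hBc, show Real.exp (2 * t + 4 * δ₀) = Real.exp (t + 2 * δ₀) ^ 2 by rw [← Real.exp_nat_mul]; ring_nf]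
          ring
  -- (7) the centred axial gauge around `x` and the mean-value inequality
  have hψharm : ∀ y, supDist x y ≤ 4 * P.L ^ k + 2 →
      (nOp (B1RG242Torus.α P a k * (P.L : ℝ) ^ (k * P.d)) P.eps⁻¹ (GaugeField.gaugeAct (centredGauge U x (2 * P.L ^ k)) U) k univ *ᵥ
        fun y => toC (centredGauge U x (2 * P.L ^ k) y) * v y) y = 0 := by
    intro y hy
    rw [nOp_gaugeAct_mulVec_smul hk0]
    show toC _ * _ = 0
    rw [hharm y (by have := depth_le_add h1 h2 x y; omega), mul_zero]
  have hγn : ((P.d - 1 : ℕ) : ℝ) * θ * ((P.L : ℝ) ^ k) ^ 2 ≤ 1 := gamma_nsq_le_one hθ0 P.hd hsmall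
  have hgauge : ∀ y (ν : Fin P.d), supDist x y ≤ 2 * P.L ^ k →
      ‖cfg (GaugeField.gaugeAct (centredGauge U x (2 * P.L ^ k)) U) ⟨y, ν⟩ - 1‖ ≤ ((P.d - 1 : ℕ) : ℝ) * θ * supDist x y := by
    intro y ν hy
    have hR : 2 * (2 * P.L ^ k) + 4 < P.sitesPerDir 0 := by omega
    have hh := dist1_centredGauge_le U hθ0 (dist1_plaqHol_le_of_plaqC U hθ) x hR y hy ν
    rw [BIJ88Smooth43Axial.dist1_eq_norm_toC_sub_one] at hh
    calc ‖cfg (GaugeField.gaugeAct (centredGauge U x (2 * P.L ^ k)) U) ⟨y, ν⟩ - 1‖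
        = ‖toC (GaugeField.gaugeAct (centredGauge U x (2 * P.L ^ k)) U ⟨y, ν⟩) - 1‖ := rfl
      _ ≤ ((P.d - 1 : ℕ) : ℝ) * (supDist x y : ℝ) * θ := hh
      _ = ((P.d - 1 : ℕ) : ℝ) * θ * supDist x y := by ring
  have hmvx := hmv P rfl rfl k hk1 hkK (by omega) x _ _ (((P.d - 1 : ℕ) : ℝ) * θ) (by positivity) hψharm hgauge
  have hnormψ : ∀ y, ‖toC (centredGauge U x (2 * P.L ^ k) y) * v y‖ = ‖v y‖ := fun y => by rw [norm_mul, norm_toC, one_mul]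
  simp only [hnormψ] at hmvx
  -- (8) conclusion
  have hmvx' : ‖v x‖ * Real.sqrt (((P.L : ℝ) ^ k) ^ P.d) ≤ 2 * Cmv * Real.sqrt (∑ y ∈ ball x (5 * P.L ^ k + 2), ‖v y‖ ^ 2) := by
    refine hmvx.trans (mul_le_mul_of_nonneg_right ?_ (Real.sqrt_nonneg _))
    nlinarith
  have hfin := sqrt_step (by positivity : 0 ≤ 2 * P.spacing k ^ 2 * c₀ * F * Real.exp (t + 2 * δ₀) * EXP) hBc0 (pow_pos hn0 _)
    hCmv.le hS' hmvx'
  calc ‖v x‖ ≤ 2 * Cmv * (2 * P.spacing k ^ 2 * c₀ * F * Real.exp (t + 2 * δ₀) * EXP) * Real.sqrt Bc := hfin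
    _ = P.spacing k ^ 2 * (2 * Cmv * (2 * c₀ * Real.exp (t + 2 * δ₀)) * Real.sqrt Bc) * EXP * F := by ring
    _ ≤ P.spacing k ^ 2 * (2 * Cmv * (2 * c₀ * Real.exp (t + 2 * δ₀)) * Real.sqrt Bc + 1) * EXP * F := by
        have h0 : 0 ≤ P.spacing k ^ 2 * EXP * F := by positivity
        nlinarith

/-- **THE SAME, LITERALLY AS HYPOTHESIS `hC` OF `BIJ88DeltaLocClose235General.opClose231_gen`**: for a family of `k`-block unions
`□_α ⊆ Ω` (the cubes of the partition of unity) with row sets `X_α` of sites of `□_α` at sup-depth `≥ 10L^k`, and the (H1.10″) value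
members of every `G_k(□_α,u)` and of `G_k(Ω,u)` on the rows of the `□_α`: the (H1.12″) closeness binder with constants `(c₁, δ₁)`.
[cite: Balaban1983RegularityDecay, Theorem p.573 (1.11)–(1.12)] [cite: BalabanImbrieJaffe1988, (2.31) p.263] -/
theorem close112_smallField_hC (d L : ℕ) (hd : 2 ≤ d) (hd3 : d ≤ 3) (hL : Odd L ∧ 1 < L) {a : ℝ} (ha : 0 < a)
    {c₀ δ₀ : ℝ} (hc₀ : 0 ≤ c₀) (hδ₀ : 0 < δ₀) :
    ∃ c₁ δ₁ : ℝ, 0 < c₁ ∧ 0 < δ₁ ∧ ∀ (P : Params), P.d = d → P.L = L → ∀ k : ℕ, 1 ≤ k → k ≤ P.K →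
      ∀ (U : GaugeField P 0 U1) (θ : ℝ), (∀ (y : Balaban1983to89.Site P 0) (μ ν : Fin P.d), ‖BIJ85AbelianStokes.plaqC U y μ ν - 1‖ ≤ θ) →
      2 * (P.d : ℝ) ^ 3 * (((P.L : ℝ) ^ k) ^ 2 * θ) ^ 2 ≤ 1 →
      ∀ (Ω : Finset (Balaban1983to89.Site P 0)) {ι : Type*} (cube Xr : ι → Finset (Balaban1983to89.Site P 0)),
      IsBlockUnion k Ω → (∀ α, IsBlockUnion k (cube α)) → (∀ α, cube α ⊆ Ω) →
      (∀ α, ∀ x ∈ Xr α, x ∈ cube α ∧ ∀ w, w ∉ cube α → 10 * (P.L : ℝ) ^ k ≤ B5Ineq137Torus.T P 0 x w) →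
      (∀ α, ∀ x ∈ cube α, ∀ (f : Balaban1983to89.Site P 0 → ℂ) (F D : ℝ), (∀ y, ‖f y‖ ≤ F) → 0 ≤ D →
          (∀ y, f y ≠ 0 → D ≤ B5Ineq137Torus.T P 0 x y) →
          ‖(gBox (B1RG242Torus.α P a k * (P.L : ℝ) ^ (k * P.d)) P.eps⁻¹ U k (cube α) *ᵥ f) x‖ ≤
            P.spacing k ^ 2 * (c₀ * Real.exp (-(δ₀ * (((P.L : ℝ) ^ k)⁻¹ * D))) * F)) →
      (∀ α, ∀ x ∈ cube α, ∀ (f : Balaban1983to89.Site P 0 → ℂ) (F D : ℝ), (∀ y, ‖f y‖ ≤ F) → 0 ≤ D →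
          (∀ y, f y ≠ 0 → D ≤ B5Ineq137Torus.T P 0 x y) →
          ‖(gBox (B1RG242Torus.α P a k * (P.L : ℝ) ^ (k * P.d)) P.eps⁻¹ U k Ω *ᵥ f) x‖ ≤
            P.spacing k ^ 2 * (c₀ * Real.exp (-(δ₀ * (((P.L : ℝ) ^ k)⁻¹ * D))) * F)) →
      ∀ α, ∀ x ∈ Xr α, ∀ (f : Balaban1983to89.Site P 0 → ℂ) (F D Db Df : ℝ), (∀ y, ‖f y‖ ≤ F) → (∀ y, y ∉ cube α → f y = 0) →
        0 ≤ D → (∀ y, f y ≠ 0 → D ≤ B5Ineq137Torus.T P 0 x y) → 0 ≤ Db → (∀ w, w ∉ cube α → Db ≤ B5Ineq137Torus.T P 0 x w) →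
        0 ≤ Df → (∀ y, f y ≠ 0 → ∀ w, w ∉ cube α → Df ≤ B5Ineq137Torus.T P 0 y w) →
        ‖(gBox (B1RG242Torus.α P a k * (P.L : ℝ) ^ (k * P.d)) P.eps⁻¹ U k (cube α) *ᵥ f) x -
            (gBox (B1RG242Torus.α P a k * (P.L : ℝ) ^ (k * P.d)) P.eps⁻¹ U k Ω *ᵥ f) x‖ ≤
          P.spacing k ^ 2 * (c₁ * Real.exp (-(δ₁ * (((P.L : ℝ) ^ k)⁻¹ * D))) *
            Real.exp (-(δ₁ * (((P.L : ℝ) ^ k)⁻¹ * (Db + Df)))) * F) := by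
  obtain ⟨c₁, δ₁, hc₁, hδ₁, h⟩ := close112_smallField_of_inputs d L hd hd3 hL ha hc₀ hδ₀
  refine ⟨c₁, δ₁, hc₁, hδ₁, ?_⟩
  intro P hPd hPL k hk1 hkK U θ hθ hsmall Ω ι cube Xr hΩ hcube hsub hXr hGcube hGΩ α x hx
  exact h P hPd hPL k hk1 hkK U θ hθ hsmall (cube α) Ω (hcube α) hΩ (hsub α) (hGcube α) (hGΩ α) x (hXr α x hx).1 (hXr α x hx).2

end Main

end

end Literature.MathematicalPhysics.QuantumFieldTheory.BalabanImbrieJaffe1984to88.BIJ88NeumannPropagatorSmallFieldClose
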